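import Mathlib

/-!
# Sketch — crux-ideate k1 g34, crux `SignedMuSeedAtTwoPlus` (stmt-BirchSwinnertonDyer-21438)
Idea `washington-period-transfer`: first checkable statements of the line, typed over Mathlib only.

* `PeriodTransfer` — the one-bit transfer principle: in the fraction field of a valuation ring,
  a scalar `c = Ω⁰/Ω₁` such that (a) `c · u₀` is integral for some unit `u₀` (some modular-symbol
  value is a unit multiple of `Ω⁰` and all values are `Ω₁`-integral) and (b) `c · t` is a UNIT for
  some integral `t` (ONE horizontal twisted value is an `Ω₁`-unit) is itself a unit: the period bit
  `v(Ω⁰/Ω₁)` vanishes, hence `μ(L^±(g;Ω₁)) = μ(L^±(g;Ω⁰)) = 0`.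
* `LevelSetInversion` — finite Fourier inversion used to pass from "all norm-twisted torsion sums
  of `G` over `Ẽ[b]` vanish" to "every norm-level-set sum of `G` vanishes" (`b` odd, so `b` is a
  unit in characteristic `2` and a primitive `b`-th root of unity exists in `𝔽̄₂`).
-/

namespace Summit.BirchSwinnertonDyer.BirchSwinnertonDyer.Cruxes.SignedMuSeedAtTwoPlus.WashingtonPeriodTransfer

/-- Period-bit transfer: integrality against a unit witness plus one unit value forces the period
ratio to be a unit (valuation-ring bookkeeping; the number theory is in producing hypothesis (b)). -/
def PeriodTransfer : Prop :=
  ∀ (𝒪 K : Type) [CommRing 𝒪] [IsDomain 𝒪] [ValuationRing 𝒪] [Field K] [Algebra 𝒪 K]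
    [IsFractionRing 𝒪 K] (c : K),
    (∃ u₀ : 𝒪ˣ, ∃ y : 𝒪, c * algebraMap 𝒪 K (u₀ : 𝒪) = algebraMap 𝒪 K y) →
    (∃ t : 𝒪, ∃ u : 𝒪ˣ, c * algebraMap 𝒪 K t = algebraMap 𝒪 K (u : 𝒪)) →
    ∃ w : 𝒪ˣ, algebraMap 𝒪 K (w : 𝒪) = c

/-- Level-set inversion: if every additively-twisted sum `∑_x ζ^{a·N(x)} G(x)` over a finite set
vanishes, then every level-set sum `∑_{N(x) = n} G(x)` vanishes (`b` invertible in `R`, `ζ` a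
primitive `b`-th root of unity). Applied with `X = Ẽ[b]`, `N` = the norm form, `R ⊇ 𝔽̄₂`. -/
def LevelSetInversion : Prop :=
  ∀ (R : Type) [CommRing R] [IsDomain R] (b : ℕ) [NeZero b], IsUnit (b : R) →
    ∀ (ζ : R), IsPrimitiveRoot ζ b →
    ∀ (X : Type) [Fintype X] (N : X → ZMod b) (G : X → R),
      (∀ a : ZMod b, ∑ x, ζ ^ (a * N x).val * G x = 0) →
      ∀ n : ZMod b, ∑ x ∈ Finset.univ.filter (fun x => N x = n), G x = 0

/-- The transfer principle holds (pure valuation-ring algebra; in fact any domain suffices). -/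
theorem periodTransfer_holds : PeriodTransfer := by
  intro 𝒪 K _ _ _ _ _ _ c ⟨u₀, y, hy⟩ ⟨t, u, hu⟩
  have hinj : Function.Injective (algebraMap 𝒪 K) := IsFractionRing.injective 𝒪 K
  have hu₀K : algebraMap 𝒪 K (u₀ : 𝒪) ≠ 0 := fun h =>
    u₀.ne_zero (hinj (by rw [h, map_zero]))
  -- `c = algebraMap z` with `z = y * u₀⁻¹`
  set z : 𝒪 := y * ↑u₀⁻¹ with hz
  have hzK : algebraMap 𝒪 K z * algebraMap 𝒪 K (u₀ : 𝒪) = algebraMap 𝒪 K y := by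
    rw [← map_mul, hz, mul_assoc, Units.inv_mul, mul_one]
  have hc : c = algebraMap 𝒪 K z := by
    apply mul_right_cancel₀ hu₀K
    rw [hy, hzK]
  -- `z * t = u`, so `z` is a unit
  have hzt : z * t = (u : 𝒪) := by
    apply hinj
    rw [map_mul, ← hc, hu]
  have hunit : IsUnit z := by
    refine isUnit_iff_exists_inv.mpr ⟨t * ↑u⁻¹, ?_⟩
    rw [← mul_assoc, hzt, Units.mul_inv]
  obtain ⟨w, hw⟩ := hunit
  exact ⟨w, by rw [hw, hc]⟩

end Summit.BirchSwinnertonDyer.BirchSwinnertonDyer.Cruxes.SignedMuSeedAtTwoPlus.WashingtonPeriodTransfer
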